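import Literature.Computability.AlgebraicComplexity.IMMStarWalks
import Literature.Computability.AlgebraicComplexity.RandomRestrictionCounting
import HarnessLib

/-!
# The space of restrictions of `IMM^*` and the survival of high-support monomials
(Kumar–Saraf 2017, §8.3, Lemma 8.2)

Topic `Literature/Computability/AlgebraicComplexity`; infrastructure for the printed proof of
`kumarSaraf2017_imm_homDepthFour` (`HomogeneousDepthFour.lean`), Steps 1 and 7 of the roadmap.
The distribution `𝒟` of [KS, §8.3] is the uniform distribution on
`Ω = rowSpace degR` (`RandomRestrictionCounting.lean`) over the row index type
`RowIdx r k ñ = Fin r ⊕ (Fin r × (Fin k × Fin ñ))`: the row `inl b` is the first row of the special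
matrix `Y` of block `b` (of which `q` entries are kept: `degR (inl b) = q`), the row `inr (b, (j, u))`
is the row `u` of the regular matrix `X_j` of block `b` (`deg j` entries kept).

* `Spart ω`, `Xpart ω` — the kept `Y`-columns and the row choices of `ω`; `sum_Omega_Xpart` —
  a function of the row choices alone sums over `Ω` to `|Ω_S| ·` its sum over
  `Ξ^r = piFinset (rowSpace deg)` (the form of `sum_T2X_le`, `sum_T3X_le`); `card_Omega`.
* `varRow` — the row index and column of a variable of `IMM` that can be kept (`none` for the
  variables that `ρ_{J,V}` never keeps: other rows of `Y`, `J` layers, identity layers);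
  `mem_Vset_iff_varRow` — `x ∈ Vset S ξ` iff its row is `some (ρ, c)` with `c` kept in row `ρ`.
* **`card_survive_mul_le`** — [KS, Lemma 8.2, per monomial]: for a set `A` of variables off
  `Jset`, `#{ω : A ⊆ Vset ω} · ñ^{|A|} ≤ |Ω| · dmax^{|A|}` (`dmax ≥ q, deg`); and the union bound
  **`card_bad₁_mul_le`**: `#{ω : some A ∈ B with |A ∖ Jset| > s survives} · ñ^{s+1} ≤ |B| |Ω| dmax^{s+1}`.
* `markov_real` — `a · #{ω : a ≤ f ω} ≤ ∑ f` for real `f ≥ 0`.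

Everything is proved; no named facts.

## References

* M. Kumar, S. Saraf, *On the power of homogeneous depth 4 arithmetic circuits*, SIAM J. Comput.
  46 (2017) 336–387 (arXiv:1404.1950): §8.3, Lemma 8.2.
-/

noncomputable section

namespace Literature.Computability.AlgebraicComplexity.KumarSaraf

open Finset IMMWalk

/-! ### The sample space -/

/-- The rows of the random restriction: the first rows of the special matrices, and the rows of
the regular matrices. [cite: KumarSaraf2017, §8.3] -/
abbrev RowIdx (r k N : ℕ) := Fin r ⊕ (Fin r × (Fin k × Fin N))

variable {r k e N : ℕ} (hN : 0 < N)

/-- The number of entries kept in each row. [cite: KumarSaraf2017, §8.3] -/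
def degR (q : ℕ) (deg : Fin k → ℕ) : RowIdx r k N → ℕ :=
  fun ρ => Sum.elim (fun _ => q) (fun p => deg p.2.1) ρ

/-- **The space of restrictions `Ω`** (the support of `𝒟`, [KS, §8.3]). [cite: KumarSaraf2017, §8.3] -/
def Omega (r k N q : ℕ) (deg : Fin k → ℕ) : Finset (RowIdx r k N → Finset (Fin N)) :=
  rowSpace (degR (r := r) (N := N) q deg)

/-- The kept `Y`-columns of a restriction. [cite: KumarSaraf2017, §8.3] -/
def Spart (ω : RowIdx r k N → Finset (Fin N)) : Fin r → Finset (Fin N) := fun b => ω (Sum.inl b)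

/-- The row choices of a restriction. [cite: KumarSaraf2017, §8.3] -/
def Xpart (ω : RowIdx r k N → Finset (Fin N)) : Fin r → Fin k × Fin N → Finset (Fin N) :=
  fun b ρ => ω (Sum.inr (b, ρ))

/-- The `Y`-part of the space. [cite: KumarSaraf2017, §8.3] -/
def OmegaS (r N q : ℕ) : Finset (Fin r → Finset (Fin N)) :=
  Fintype.piFinset fun _ : Fin r => powersetCard q (univ : Finset (Fin N))

/-- The `X`-part of the space: `Ξ^r`. [cite: KumarSaraf2017, §8.3] -/
def OmegaX (r k N : ℕ) (deg : Fin k → ℕ) : Finset (Fin r → Fin k × Fin N → Finset (Fin N)) :=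
  Fintype.piFinset fun _ : Fin r => rowSpace (fun ρ : Fin k × Fin N => deg ρ.1)

/-- **`Ω ≅ Ω_S × Ξ^r`**: summing `F(Spart ω, Xpart ω)` over `Ω`. [folklore] -/
theorem sum_Omega_eq (q : ℕ) (deg : Fin k → ℕ) {M : Type*} [AddCommMonoid M]
    (F : (Fin r → Finset (Fin N)) → (Fin r → Fin k × Fin N → Finset (Fin N)) → M) :
    ∑ ω ∈ Omega r k N q deg, F (Spart ω) (Xpart ω) =
      ∑ p ∈ OmegaS r N q ×ˢ OmegaX r k N deg, F p.1 p.2 := by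
  classical
  refine sum_nbij' (fun ω => (Spart ω, Xpart ω))
    (fun p => fun ρ => Sum.elim p.1 (fun x => p.2 x.1 x.2) ρ) ?_ ?_ ?_ ?_ ?_
  · intro ω hω
    rw [Omega, rowSpace, Fintype.mem_piFinset] at hω
    rw [mem_product, OmegaS, OmegaX, Fintype.mem_piFinset, Fintype.mem_piFinset]
    refine ⟨fun b => hω (Sum.inl b), fun b => ?_⟩
    rw [rowSpace, Fintype.mem_piFinset]
    exact fun ρ => hω (Sum.inr (b, ρ))
  · intro p hp
    rw [mem_product, OmegaS, OmegaX, Fintype.mem_piFinset, Fintype.mem_piFinset] at hp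
    rw [Omega, rowSpace, Fintype.mem_piFinset]
    rintro (b | ⟨b, ρ⟩)
    · exact hp.1 b
    · have := hp.2 b
      rw [rowSpace, Fintype.mem_piFinset] at this
      exact this ρ
  · intro ω _
    funext ρ; rcases ρ with b | ⟨b, ρ⟩ <;> rfl
  · intro p _
    rfl
  · intro ω _; rfl

/-- **A function of the row choices sums over `Ω` to `|Ω_S|` times its sum over `Ξ^r`.**
[folklore] -/
theorem sum_Omega_Xpart (q : ℕ) (deg : Fin k → ℕ) {M : Type*} [AddCommMonoid M]
    (F : (Fin r → Fin k × Fin N → Finset (Fin N)) → M) :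
    ∑ ω ∈ Omega r k N q deg, F (Xpart ω) = (OmegaS r N q).card • ∑ ξ ∈ OmegaX r k N deg, F ξ := by
  rw [sum_Omega_eq q deg (fun _ ξ => F ξ), sum_product]
  show ∑ _x ∈ OmegaS r N q, ∑ y ∈ OmegaX r k N deg, F y = _
  rw [sum_const]

/-- `|Ω| = |Ω_S| · |Ξ^r|`. [folklore] -/
theorem card_Omega (q : ℕ) (deg : Fin k → ℕ) :
    (Omega r k N q deg).card = (OmegaS r N q).card * (OmegaX r k N deg).card := by
  have h := sum_Omega_Xpart (r := r) (k := k) (N := N) q deg (fun _ => (1 : ℕ))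
  simpa using h

/-- `Ω` is nonempty when `q ≤ ñ` and `deg ≤ ñ`. [folklore] -/
theorem Omega_nonempty {q : ℕ} (hq : q ≤ N) {deg : Fin k → ℕ} (hdeg : ∀ j, deg j ≤ N) :
    (Omega r k N q deg).Nonempty := by
  rw [Omega, ← card_pos, card_rowSpace]
  refine prod_pos fun ρ _ => Nat.choose_pos ?_
  rw [Fintype.card_fin]
  rcases ρ with b | ⟨b, j, u⟩
  · exact hq
  · exact hdeg j

/-! ### Rows of variables -/

/-- **The row (and column) of a variable that can be kept**: `inl b` for an entry `(0, c)` of the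
special matrix of block `b`, `inr (b, (j, u))` for an entry `(u, c)` of `X_j` of block `b`; `none`
for the variables never kept. [cite: KumarSaraf2017, §8.3] -/
def varRow (x : Fin (nL r k e) × Fin N × Fin N) : Option (RowIdx r k N × Fin N) :=
  if ht : (x.1 : ℕ) < r * (k + 2) then
    if h0 : (x.1 : ℕ) % (k + 2) = 0 then
      (if x.2.1 = v0 hN then some (Sum.inl ⟨(x.1 : ℕ) / (k + 2), (div_mod_of_lt ht).1⟩, x.2.2)
        else none)
    else if hk : (x.1 : ℕ) % (k + 2) ≤ k then
      some (Sum.inr (⟨(x.1 : ℕ) / (k + 2), (div_mod_of_lt ht).1⟩,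
        (⟨(x.1 : ℕ) % (k + 2) - 1, by omega⟩, x.2.1)), x.2.2)
    else none
  else none

/-- The row of a kept `Y`-entry. [folklore] -/
theorem varRow_Y (b : Fin r) (c : Fin N) :
    varRow (k := k) (e := e) hN (posY (k := k) b, v0 hN, c) = some (Sum.inl b, c) := by
  unfold varRow
  have hlt := posY_val_lt (k := k) (e := e) b
  have h0 := (pos_div_mod (k := k) b 0 (by omega))
  rw [add_zero] at h0
  have hval : ((posY (k := k) (e := e) b : Fin (nL r k e)) : ℕ) = b * (k + 2) := rfl
  have h0' : ((posY (k := k) (e := e) b : Fin (nL r k e)) : ℕ) % (k + 2) = 0 := by rw [hval, h0.2]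
  dsimp only
  rw [dif_pos hlt, dif_pos h0', if_pos rfl]
  simp only [Option.some.injEq, Prod.mk.injEq, Sum.inl.injEq, and_true]
  exact Fin.ext (by rw [Fin.val_mk, hval, h0.1])

/-- The row of an `X`-entry. [folklore] -/
theorem varRow_X (b : Fin r) (j : Fin k) (u c : Fin N) :
    varRow (e := e) hN (posX b j.castSucc, u, c) = some (Sum.inr (b, (j, u)), c) := by
  unfold varRow
  have hlt := posX_val_lt (e := e) b j.castSucc
  have hj := j.2
  have h1 := pos_div_mod (k := k) b (1 + j) (by omega)
  rw [← add_assoc] at h1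
  have hval : (((posX (e := e) b j.castSucc, u, c) : Fin (nL r k e) × Fin N × Fin N).1 : ℕ) =
      b * (k + 2) + 1 + j := rfl
  have hne : ¬ (((posX (e := e) b j.castSucc, u, c) : Fin (nL r k e) × Fin N × Fin N).1 : ℕ) % (k + 2) = 0 := by
    rw [hval, h1.2]; omega
  have hle : (((posX (e := e) b j.castSucc, u, c) : Fin (nL r k e) × Fin N × Fin N).1 : ℕ) % (k + 2) ≤ k := by
    rw [hval, h1.2]; omega
  rw [dif_pos hlt, dif_neg hne, dif_pos hle]
  simp only [Option.some.injEq, Prod.mk.injEq, Sum.inr.injEq, and_true]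
  refine ⟨Fin.ext ?_, Fin.ext ?_⟩
  · rw [Fin.val_mk, posX_val, Fin.val_castSucc, h1.1]
  · rw [Fin.val_mk, posX_val, Fin.val_castSucc, h1.2]; omega

/-- **The variables with a row**: `varRow x = some (ρ, c)` iff `x` is the kept-type entry of row `ρ`
and column `c`. [folklore] -/
theorem varRow_eq_some_iff (x : Fin (nL r k e) × Fin N × Fin N) (ρc : RowIdx r k N × Fin N) :
    varRow (e := e) hN x = some ρc ↔
      (∃ b, ρc.1 = Sum.inl b ∧ x = (posY b, v0 hN, ρc.2)) ∨
      (∃ b j u, ρc.1 = Sum.inr (b, (j, u)) ∧ x = (posX b j.castSucc, u, ρc.2)) := by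
  constructor
  · intro hρ
    unfold varRow at hρ
    split_ifs at hρ with ht h0 hv hk
    · -- `Y` entry
      rw [Option.some.injEq] at hρ
      left
      refine ⟨⟨(x.1 : ℕ) / (k + 2), (div_mod_of_lt ht).1⟩, by rw [← hρ], ?_⟩
      rw [← hρ]
      rcases x with ⟨t, i, c⟩
      simp only at hv ⊢
      refine Prod.ext (Fin.ext ?_) (Prod.ext hv rfl)
      have := (div_mod_of_lt ht).2.1
      simp only at h0 this ⊢
      simp only [posY_val]; omega
    · -- `X` entry
      rw [Option.some.injEq] at hρ
      right
      refine ⟨⟨(x.1 : ℕ) / (k + 2), (div_mod_of_lt ht).1⟩, ⟨(x.1 : ℕ) % (k + 2) - 1, by omega⟩, x.2.1,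
        by rw [← hρ], ?_⟩
      rw [← hρ]
      rcases x with ⟨t, i, c⟩
      refine Prod.ext (Fin.ext ?_) rfl
      have := (div_mod_of_lt ht).2.1
      simp only at h0 this ⊢
      simp only [posX_val, Fin.val_castSucc]; omega
  · rintro (⟨b, h1, rfl⟩ | ⟨b, j, u, h1, rfl⟩)
    · rw [varRow_Y]; rcases ρc with ⟨ρ, c⟩; simp only at h1 ⊢; rw [h1]
    · rw [varRow_X]; rcases ρc with ⟨ρ, c⟩; simp only at h1 ⊢; rw [h1]

/-- **Kept variables are exactly those whose row is defined and whose column is kept in it.**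
[cite: KumarSaraf2017, §8.3] -/
theorem mem_Vset_iff_varRow (S : Fin r → Finset (Fin N))
    (ξ : Fin r → Fin k × Fin N → Finset (Fin N)) (x : Fin (nL r k e) × Fin N × Fin N) :
    x ∈ Vset (e := e) hN S ξ ↔ ∃ ρc, varRow (e := e) hN x = some ρc ∧
      ρc.2 ∈ Sum.elim S (fun p => ξ p.1 p.2) ρc.1 := by
  constructor
  · intro hx
    rw [Vset, mem_filter] at hx
    rcases hx.2 with ⟨b, h1, h2, h3⟩ | ⟨b, j, h1, h2⟩
    · refine ⟨(Sum.inl b, x.2.2), ?_, h3⟩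
      have : x = (posY b, v0 hN, x.2.2) := by
        rcases x with ⟨t, i, c⟩; simp only at h1 h2 ⊢; rw [h1, h2]
      rw [this, varRow_Y]
    · refine ⟨(Sum.inr (b, (j, x.2.1)), x.2.2), ?_, h2⟩
      have : x = (posX b j.castSucc, x.2.1, x.2.2) := by
        rcases x with ⟨t, i, c⟩; simp only at h1 ⊢; rw [h1]
      rw [this, varRow_X]
  · rintro ⟨ρc, hρ, hc⟩
    rw [Vset, mem_filter]
    refine ⟨mem_univ _, ?_⟩
    rcases (varRow_eq_some_iff hN x ρc).1 hρ with ⟨b, h1, rfl⟩ | ⟨b, j, u, h1, rfl⟩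
    · left
      rw [h1] at hc
      exact ⟨b, rfl, rfl, hc⟩
    · right
      rw [h1] at hc
      exact ⟨b, j, rfl, hc⟩

/-- Variables with the same row and column are equal. [folklore] -/
theorem eq_of_varRow_eq {x y : Fin (nL r k e) × Fin N × Fin N} {ρc : RowIdx r k N × Fin N}
    (hx : varRow (e := e) hN x = some ρc) (hy : varRow (e := e) hN y = some ρc) : x = y := by
  rcases (varRow_eq_some_iff hN x ρc).1 hx with ⟨b, h1, rfl⟩ | ⟨b, j, u, h1, rfl⟩ <;>
    rcases (varRow_eq_some_iff hN y ρc).1 hy with ⟨b', h1', rfl⟩ | ⟨b', j', u', h1', rfl⟩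
  · rw [h1] at h1'; cases h1'; rfl
  · rw [h1] at h1'; cases h1'
  · rw [h1] at h1'; cases h1'
  · rw [h1] at h1'; cases h1'; rfl

/-- The column recorded by `varRow` is the column of the variable. [folklore] -/
theorem varRow_snd {x : Fin (nL r k e) × Fin N × Fin N} {ρc : RowIdx r k N × Fin N}
    (hx : varRow (e := e) hN x = some ρc) : ρc.2 = x.2.2 := by
  rcases (varRow_eq_some_iff hN x ρc).1 hx with ⟨b, -, rfl⟩ | ⟨b, j, u, -, rfl⟩ <;> rfl

/-! ### Survival of a set of variables -/

/-- The columns of the variables of `A` in row `ρ`. [cite: KumarSaraf2017, Lemma 8.2] -/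
def rowCols (A : Finset (Fin (nL r k e) × Fin N × Fin N)) (ρ : RowIdx r k N) : Finset (Fin N) :=
  (A.filter fun x => (varRow (e := e) hN x).map Prod.fst = some ρ).image fun x => x.2.2

/-- If every variable of `A` has a row, the row column sets partition `A`:
`∑_ρ |rowCols A ρ| = |A|`. [folklore] -/
theorem sum_card_rowCols {A : Finset (Fin (nL r k e) × Fin N × Fin N)}
    (hA : ∀ x ∈ A, varRow (e := e) hN x ≠ none) :
    ∑ ρ, (rowCols (e := e) hN A ρ).card = A.card := by
  classical
  -- `x ↦ row x` fibres `A`; on each fibre `x ↦ x.2.2` is injective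
  have hinj : ∀ ρ : RowIdx r k N, Set.InjOn (fun x : Fin (nL r k e) × Fin N × Fin N => x.2.2)
      ↑(A.filter fun x => (varRow (e := e) hN x).map Prod.fst = some ρ) := by
    intro ρ x hx y hy hxy
    rw [mem_coe, mem_filter] at hx hy
    obtain ⟨ρx, hρx⟩ := Option.ne_none_iff_exists'.1 (hA x hx.1)
    obtain ⟨ρy, hρy⟩ := Option.ne_none_iff_exists'.1 (hA y hy.1)
    rw [hρx, Option.map_some, Option.some.injEq] at hx
    rw [hρy, Option.map_some, Option.some.injEq] at hy
    have hcx : ρx.2 = x.2.2 := varRow_snd hN hρx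
    have hcy : ρy.2 = y.2.2 := varRow_snd hN hρy
    have hρeq : ρx = ρy := Prod.ext (hx.2.trans hy.2.symm) (by rw [hcx, hcy]; exact hxy)
    rw [hρeq] at hρx
    exact eq_of_varRow_eq hN hρx hρy
  have hcard : ∀ ρ, (rowCols (e := e) hN A ρ).card =
      (A.filter fun x => (varRow (e := e) hN x).map Prod.fst = some ρ).card := fun ρ =>
    card_image_of_injOn (hinj ρ)
  simp_rw [hcard]
  have htot := card_eq_sum_card_fiberwise (f := fun x => (varRow (e := e) hN x).map Prod.fst)
    (s := A) (t := (univ : Finset (Option (RowIdx r k N)))) (fun _ _ => mem_univ _)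
  rw [htot, Fintype.sum_option]
  have hnone : (A.filter fun x => (varRow (e := e) hN x).map Prod.fst = none).card = 0 := by
    rw [card_eq_zero, filter_eq_empty_iff]
    intro x hx h
    rw [Option.map_eq_none_iff] at h
    exact hA x hx h
  rw [hnone, zero_add]

/-- On `Ω`, the elimination of `Spart`/`Xpart` is the restriction itself. [folklore] -/
theorem sumElim_Spart_Xpart (ω : RowIdx r k N → Finset (Fin N)) (ρ : RowIdx r k N) :
    Sum.elim (Spart ω) (fun p => Xpart ω p.1 p.2) ρ = ω ρ := by
  rcases ρ with b | ⟨b, ρ⟩ <;> rfl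

/-- **Kumar–Saraf 2017, Lemma 8.2 (per monomial, counting form).** For a set `A` of variables,
`#{ω ∈ Ω : A ⊆ Vset ω} · ñ^{|A|} ≤ |Ω| · dmax^{|A|}` whenever `q, deg ≤ dmax`: each variable of `A`
survives with probability at most `dmax/ñ`, independently across rows and jointly within a row.
[cite: KumarSaraf2017, Lemma 8.2] -/
theorem card_survive_mul_le (q : ℕ) (deg : Fin k → ℕ) {dmax : ℕ} (hq : q ≤ dmax)
    (hdeg : ∀ j, deg j ≤ dmax) (A : Finset (Fin (nL r k e) × Fin N × Fin N)) :
    ((Omega r k N q deg).filter fun ω => A ⊆ Vset (e := e) hN (Spart ω) (Xpart ω)).card * N ^ A.card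
      ≤ (Omega r k N q deg).card * dmax ^ A.card := by
  classical
  by_cases hnone : ∃ x ∈ A, varRow (e := e) hN x = none
  · -- a variable that is never kept: nothing survives
    obtain ⟨x, hxA, hx⟩ := hnone
    have h0 : ((Omega r k N q deg).filter fun ω => A ⊆ Vset (e := e) hN (Spart ω) (Xpart ω)) = ∅ := by
      rw [filter_eq_empty_iff]
      intro ω _ hsub
      obtain ⟨ρc, hρ, -⟩ := (mem_Vset_iff_varRow hN _ _ x).1 (hsub hxA)
      rw [hx] at hρ; exact absurd hρ (by simp)
    rw [h0, card_empty, zero_mul]; exact Nat.zero_le _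
  push Not at hnone
  have hsub : ((Omega r k N q deg).filter fun ω => A ⊆ Vset (e := e) hN (Spart ω) (Xpart ω)) ⊆
      (rowSpace (degR (r := r) (N := N) q deg)).filter fun ω => ∀ ρ, rowCols (e := e) hN A ρ ⊆ ω ρ := by
    intro ω hω
    rw [mem_filter] at hω ⊢
    refine ⟨hω.1, fun ρ c hc => ?_⟩
    rw [rowCols, mem_image] at hc
    obtain ⟨x, hx, rfl⟩ := hc
    rw [mem_filter] at hx
    obtain ⟨ρc, hρ, hkeep⟩ := (mem_Vset_iff_varRow hN _ _ x).1 (hω.2 hx.1)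
    rw [hρ, Option.map_some, Option.some.injEq] at hx
    rw [← varRow_snd hN hρ, ← sumElim_Spart_Xpart ω ρ, ← hx.2]
    exact hkeep
  have hdegR : ∀ ρ : RowIdx r k N, degR (r := r) (N := N) q deg ρ ≤ dmax := by
    rintro (b | ⟨b, j, u⟩)
    · exact hq
    · exact hdeg j
  have h := card_rowSpace_filter_superset_mul_le' (α := Fin N) (degR (r := r) (N := N) q deg) hdegR
    (rowCols (e := e) hN A)
  rw [sum_card_rowCols hN (fun x hx => hnone x hx), Fintype.card_fin] at h
  exact (Nat.mul_le_mul_right _ (card_le_card hsub)).trans h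

/-- **The union bound of [KS, Lemma 8.2]**: the restrictions under which some `A ∈ B` with more
than `s` variables off `Jset` survives are few:
`#bad · ñ^{s+1} ≤ |B| · |Ω| · dmax^{s+1}` (`dmax ≤ ñ`). [cite: KumarSaraf2017, Lemma 8.2] -/
theorem card_bad₁_mul_le (q : ℕ) (deg : Fin k → ℕ) {dmax : ℕ} (hq : q ≤ dmax)
    (hdeg : ∀ j, deg j ≤ dmax) (hdN : dmax ≤ N) (hN1 : 1 ≤ N) (s : ℕ)
    (B : Finset (Finset (Fin (nL r k e) × Fin N × Fin N))) :
    ((Omega r k N q deg).filter fun ω => ∃ A ∈ B, s < (A \ Jset (N := N)).card ∧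
        A \ Jset (N := N) ⊆ Vset (e := e) hN (Spart ω) (Xpart ω)).card * N ^ (s + 1) ≤
      B.card * (Omega r k N q deg).card * dmax ^ (s + 1) := by
  classical
  refine (Nat.mul_le_mul_right _ (card_filter_exists_le_sum _ B _)).trans ?_
  rw [sum_mul, mul_assoc, card_eq_sum_ones B, sum_mul]
  refine sum_le_sum fun A _ => ?_
  rw [one_mul]
  set A' := A \ Jset (r := r) (k := k) (e := e) (N := N) with hA'
  by_cases hs : s < A'.card
  · have h := card_survive_mul_le (e := e) hN q deg hq hdeg A'
    have hf : ((Omega r k N q deg).filter fun ω => s < A'.card ∧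
        A' ⊆ Vset (e := e) hN (Spart ω) (Xpart ω)) =
        (Omega r k N q deg).filter fun ω => A' ⊆ Vset (e := e) hN (Spart ω) (Xpart ω) := by
      refine filter_congr fun ω _ => ?_; exact ⟨fun h => h.2, fun h => ⟨hs, h⟩⟩
    rw [hf]
    -- cancel `N^{|A'| - (s+1)}` using `dmax ≤ N`
    have hsplit : A'.card = (s + 1) + (A'.card - (s + 1)) := by omega
    have h' : ((Omega r k N q deg).filter fun ω => A' ⊆ Vset (e := e) hN (Spart ω) (Xpart ω)).card *
        N ^ (s + 1) * N ^ (A'.card - (s + 1)) ≤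
        (Omega r k N q deg).card * dmax ^ (s + 1) * N ^ (A'.card - (s + 1)) := by
      calc _ = ((Omega r k N q deg).filter fun ω => A' ⊆ Vset (e := e) hN (Spart ω) (Xpart ω)).card *
            N ^ A'.card := by rw [mul_assoc, ← pow_add, ← hsplit]
        _ ≤ (Omega r k N q deg).card * dmax ^ A'.card := h
        _ = (Omega r k N q deg).card * dmax ^ (s + 1) * dmax ^ (A'.card - (s + 1)) := by
            rw [mul_assoc, ← pow_add, ← hsplit]
        _ ≤ _ := Nat.mul_le_mul_left _ (Nat.pow_le_pow_left hdN _)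
    have hpos : 0 < N ^ (A'.card - (s + 1)) := Nat.pow_pos hN1
    exact Nat.le_of_mul_le_mul_right h' hpos
  · have h0 : ((Omega r k N q deg).filter fun ω => s < A'.card ∧
        A' ⊆ Vset (e := e) hN (Spart ω) (Xpart ω)) = ∅ := by
      rw [filter_eq_empty_iff]; exact fun ω _ h => hs h.1
    rw [h0, card_empty, zero_mul]; exact Nat.zero_le _

/-- **Markov's inequality, counting form, real values.** [folklore] -/
theorem markov_real {Ω' : Type*} (S : Finset Ω') (f : Ω' → ℝ) (hf : ∀ ω ∈ S, 0 ≤ f ω) (a : ℝ)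
    [DecidablePred fun ω => a ≤ f ω] :
    a * ((S.filter fun ω => a ≤ f ω).card : ℝ) ≤ ∑ ω ∈ S, f ω :=
  calc a * ((S.filter fun ω => a ≤ f ω).card : ℝ) = ∑ _ω ∈ S.filter (fun ω => a ≤ f ω), a := by
        rw [sum_const, nsmul_eq_mul, mul_comm]
    _ ≤ ∑ ω ∈ S.filter (fun ω => a ≤ f ω), f ω := sum_le_sum fun ω hω => (mem_filter.1 hω).2
    _ ≤ ∑ ω ∈ S, f ω := sum_le_sum_of_subset_of_nonneg (filter_subset _ _) fun ω hω _ => hf ω hω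

end Literature.Computability.AlgebraicComplexity.KumarSaraf

end
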